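import Summits.CriticalPhenomena.PercolationContinuityZ3.Theorems.PercAnnulusCrossingIICLocalLimitShift
import Summits.CriticalPhenomena.PercolationContinuityZ3.Theorems.PercNonProliferationDensityWhp
import HarnessLib

/-!
# Mean ergodic averages under the IIC: the density of any local pattern in `Λ(n)` is asymptotically critical (lane RSW3, p1 gen 7)

builds on p205010 (kernel theorem, internal audit signed; external expert review pending) — used only by the `p_c(ℤ^d)` statements
(through the (A2)□ ⇒ one-arm quasi-multiplicativity bridge and `CSH.percolationContinuity_allDimensions`); the `ℤ²` statement is unconditional.

Seat `prim-rsw3-p1` (gen 7).  Cesàro form of `PercAnnulusCrossingIICLocalLimitShift.lean`: under Kesten's IIC measure `ν` the EXPECTED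
density in `Λ(n)` of the translates of any cylinder event `E` tends to `P_{p_c}(E)`, and the mixing bound holds UNIFORMLY over the event at the
other end (any cylinder event whose edges are disjoint from those of the far translate), which is the form needed for second moments.

* `tendsto_boxAverage_of_tendsto_cofinite` — Cesàro along boxes (`|Λ(n)| → ∞` is the lane's `tendsto_card_box_atTop`): if `f → L` along the cofinite filter of `ℤ^d` and `|f − L| ≤ M`, then
  `|Λ(n)|⁻¹ Σ_{x ∈ Λ(n)} f(x) → L`;
* **`iicMeasure_abs_real_inter_preimage_shift_sub_le_criticalProbI`** — UNIFORM MIXING at `p_c(ℤ^d)` under (A2)□: for every cylinder `E`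
  and `ε > 0` there is `n₀` such that for every translation `v` taking the endpoints of `E`'s edges off `Λ(n₀)` and EVERY cylinder event `G`
  on edges disjoint from those of the translate: `|ν(G ∩ {ω | ω + v ∈ E}) − ν(G)·P_{p_c}(E)| ≤ ε`;
  `iicMeasure_abs_real_inter_preimage_shift_sub_le_Z2` — the same on `ℤ²`, unconditionally;
* **`iicMeasure_tendsto_boxAverage_real_preimage_shift_criticalProbI`** — at `p_c(ℤ^d)`, `d ≥ 2`, under (A2)□ at one aspect, for every
  probability measure `ν` with the IIC limit property and every cylinder event `E`:
  **`|Λ(n)|⁻¹ Σ_{x ∈ Λ(n)} ν({ω | ω + x ∈ E}) → P_{p_c}(E)`** — the `ν`-expected density of occurrences of the pattern `E` in `Λ(n)` is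
  asymptotically its critical probability; `…_Z2` — the same on `ℤ²`, unconditionally.

Helper file for the crux `stmt-CriticalPhenomena-4575` chain; no definitions, no sorries.
References: H. Kesten, PTRF 73 (1986) 369–394, Thm. (3), (1.12)–(1.13); G. Grimmett, *Percolation* (1999), §2.2.
-/

noncomputable section

namespace Summit.CriticalPhenomena.PercolationContinuityZ3.Theorems.Crossing

open MeasureTheory ProbabilityTheory Filter Topology
open Literature.Probability.Percolation Literature.Probability.LatticeModels
open Literature.Probability.Percolation.DCT16
open scoped ENNReal ProbabilityTheory Literature.Probability.Percolation

variable {d : ℕ}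

/-! ## Cesàro averages along boxes -/

/-- **Cesàro along boxes**: if `f(x) → L` as `x → ∞` in `ℤ^d` (cofinite filter) and `|f(x) − L| ≤ M` for all `x`, then
`|Λ(n)|⁻¹ Σ_{x ∈ Λ(n)} f(x) → L` (`d ≥ 1`). [folklore] -/
theorem tendsto_boxAverage_of_tendsto_cofinite (hd : 1 ≤ d) {f : Site d → ℝ} {L M : ℝ} (hM : ∀ x, |f x - L| ≤ M)
    (hf : Tendsto f cofinite (𝓝 L)) :
    Tendsto (fun n : ℕ => (∑ x ∈ box d n, f x) / ((box d n).card : ℝ)) atTop (𝓝 L) := by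
  classical
  have hM0 : 0 ≤ M := le_trans (abs_nonneg _) (hM 0)
  rw [Metric.tendsto_nhds]
  intro ε hε
  have h1 : ∀ᶠ x in cofinite, dist (f x) L < ε / 2 := Metric.tendsto_nhds.1 hf _ (half_pos hε)
  rw [Filter.eventually_cofinite] at h1
  set B : Finset (Site d) := h1.toFinset with hB
  have hB' : ∀ x, x ∉ B → |f x - L| < ε / 2 := fun x hx => by
    by_contra h
    exact hx (h1.mem_toFinset.2 (by rwa [Set.mem_setOf_eq, Real.dist_eq]))
  have hcard := tendsto_card_box_atTop hd
  have hsmall : ∀ᶠ n : ℕ in atTop, M * B.card / ((box d n).card : ℝ) < ε / 2 :=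
    (tendsto_const_nhds.div_atTop hcard) |>.eventually (gt_mem_nhds (half_pos hε))
  have hpos : ∀ᶠ n : ℕ in atTop, (0 : ℝ) < (box d n).card := hcard.eventually (eventually_gt_atTop 0)
  filter_upwards [hsmall, hpos] with n hn hnpos
  rw [Real.dist_eq]
  have hsum : (∑ x ∈ box d n, f x) / ((box d n).card : ℝ) - L = (∑ x ∈ box d n, (f x - L)) / ((box d n).card : ℝ) := by
    rw [Finset.sum_sub_distrib, Finset.sum_const, nsmul_eq_mul]
    field_simp
  rw [hsum, abs_div, abs_of_pos hnpos, div_lt_iff₀ hnpos]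
  calc |∑ x ∈ box d n, (f x - L)| ≤ ∑ x ∈ box d n, |f x - L| := Finset.abs_sum_le_sum_abs _ _
    _ = ∑ x ∈ (box d n).filter (fun x => x ∈ B), |f x - L| + ∑ x ∈ (box d n).filter (fun x => x ∉ B), |f x - L| :=
        (Finset.sum_filter_add_sum_filter_not _ _ _).symm
    _ ≤ ∑ _x ∈ (box d n).filter (fun x => x ∈ B), M + ∑ _x ∈ (box d n).filter (fun x => x ∉ B), ε / 2 := by
        refine add_le_add (Finset.sum_le_sum fun x _ => hM x) (Finset.sum_le_sum fun x hx => (hB' x (Finset.mem_filter.1 hx).2).le)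
    _ = ((box d n).filter (fun x => x ∈ B)).card * M + ((box d n).filter (fun x => x ∉ B)).card * (ε / 2) := by
        rw [Finset.sum_const, Finset.sum_const, nsmul_eq_mul, nsmul_eq_mul]
    _ ≤ B.card * M + (box d n).card * (ε / 2) := by
        refine add_le_add (mul_le_mul_of_nonneg_right ?_ hM0) (mul_le_mul_of_nonneg_right ?_ (half_pos hε).le)
        · exact_mod_cast Finset.card_le_card fun x hx => (Finset.mem_filter.1 hx).2
        · exact_mod_cast Finset.card_filter_le _ _
    _ < ε * (box d n).card := by
        have : M * B.card < ε / 2 * (box d n).card := by rwa [div_lt_iff₀ hnpos] at hn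
        linarith

/-! ## Uniform mixing -/

/-- **UNIFORM MIXING (ℤ^d, under (A2)□)**: at `p_c(ℤ^d)`, `d ≥ 2`, under (A2)□ at aspect `(s,L)`, for every measure `ν` with Kesten's IIC limit
property, every event `E` determined by the finite edge set `F` with endpoints in `W`, and every `ε > 0`, there is `n₀` such that for every
translation `v` with `W − v` off `Λ(n₀)` and EVERY event `G` determined by a finite edge set `T` disjoint from `F − v`:
**`|ν(G ∩ {ω | ω + v ∈ E}) − ν(G)·P_{p_c}(E)| ≤ ε`** (`iicMeasure_abs_real_inter_sub_mul_le_criticalProbI` and `π_{p_c}(m) → 0`).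
[cite: Kesten1986, Thm. (3), (1.12)–(1.13)] [cite: BasuSapozhnikov2017ECP, Thm. 1.1 and §1 (A2)] -/
theorem iicMeasure_abs_real_inter_preimage_shift_sub_le_criticalProbI (hd : 2 ≤ d) {s L : ℕ} (hs : 2 ≤ s) (hsL : s ≤ L) {ϰ : ℝ}
    (hϰ : 0 < ϰ) (hA2 : SetToSetQuasiMultAspectAt d (criticalProbI d) s L ϰ) {ν : Measure (BondConfig (Site d))}
    (hν : ∀ (F : Finset (Sym2 (Site d))) (E : Set (BondConfig (Site d))), MeasurableSet E → DeterminedBy E ↑F →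
      Tendsto (fun n : ℕ => (bondPercolation (zdGraph d) (criticalProbI d)).real (E ∩ siteToBoundary d n) /
        oneArmProb d (criticalProbI d) n) atTop (𝓝 (ν.real E)))
    {F : Finset (Sym2 (Site d))} {W : Finset (Site d)} (hFW : ∀ e ∈ F, ∀ w ∈ e, w ∈ W)
    {E : Set (BondConfig (Site d))} (hE : DeterminedBy E (↑F : Set (Sym2 (Site d)))) {ε : ℝ} (hε : 0 < ε) :
    ∃ n₀ : ℕ, ∀ v : Site d, (∀ w ∈ W, w - v ∉ box d n₀) →
      ∀ (T : Finset (Sym2 (Site d))) (G : Set (BondConfig (Site d))), DeterminedBy G (↑T : Set (Sym2 (Site d))) →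
        Disjoint T (F.image (Sym2.map (Site.shift v).symm)) →
        |ν.real (G ∩ BondConfig.relabel (sym2Equiv (Site.shift v)) ⁻¹' E) -
            ν.real G * (bondPercolation (zdGraph d) (criticalProbI d)).real E| ≤ ε := by
  classical
  obtain ⟨C, hC, hb⟩ := iicMeasure_abs_real_inter_sub_mul_le_criticalProbI hd hs hsL hϰ hA2
  -- `π_{p_c}(m) → 0`
  have hθ : theta (zdGraph d) 0 (criticalProbI d) = 0 := CSH.percolationContinuity_allDimensions d hd
  have hlim : Tendsto (fun m : ℕ => oneArmProb d (criticalProbI d) m) atTop (𝓝 0) := by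
    have h := Literature.Probability.Percolation.tendsto_real_siteToBoundary (d := d) (criticalProbI d)
    rw [hθ] at h
    exact h
  set M : ℕ := W.card with hM
  have hεC : 0 < ε / (C * (M + 1)) := by positivity
  obtain ⟨m₀, hm₀⟩ := eventually_atTop.1 ((tendsto_order.1 hlim).2 (ε / (C * (M + 1))) hεC)
  refine ⟨max 7 (2 * m₀ + 2), fun v hv T G hG hdisj => ?_⟩
  have hW' : ∀ w ∈ W.image (fun x => x - v), w ∉ box d (max 7 (2 * m₀ + 2)) := by
    intro w hw
    obtain ⟨a, ha, rfl⟩ := Finset.mem_image.1 hw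
    exact hv a ha
  have hnorm : ∀ w ∈ W.image (fun x => x - v), max 7 (2 * m₀ + 2) < Site.supNorm w := fun w hw => by
    by_contra h'
    push Not at h'
    exact hW' w hw (mem_box_iff_supNorm_le.2 h')
  have hW7 : ∀ w ∈ W.image (fun x => x - v), 7 ≤ Site.supNorm w := fun w hw => by
    have h1 := hnorm w hw
    omega
  have h := hb ν hν (F.image (Sym2.map (Site.shift v).symm)) (W.image fun x => x - v) _ T G (forall_mem_image_shift hFW v)
    hW7 (determinedBy_preimage_relabel_shift hE v) hG hdisj
  rw [bondPercolation_real_preimage_shift] at h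
  refine h.trans ?_
  have hterm : ∀ w ∈ W.image (fun x => x - v), oneArmProb d (criticalProbI d) ((Site.supNorm w - 1) / 2) ≤ ε / (C * (M + 1)) :=
    fun w hw => by
      have h1 := hnorm w hw
      exact (hm₀ _ (by omega)).le
  have hcard : ((W.image fun x => x - v).card : ℝ) ≤ M := by exact_mod_cast Finset.card_image_le
  calc C * ∑ w ∈ W.image (fun x => x - v), oneArmProb d (criticalProbI d) ((Site.supNorm w - 1) / 2)
      ≤ C * ∑ _w ∈ W.image (fun x => x - v), ε / (C * (M + 1)) := mul_le_mul_of_nonneg_left (Finset.sum_le_sum hterm) hC.le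
    _ = C * ((W.image fun x => x - v).card * (ε / (C * (M + 1)))) := by rw [Finset.sum_const, nsmul_eq_mul]
    _ ≤ C * ((M : ℝ) * (ε / (C * (M + 1)))) := mul_le_mul_of_nonneg_left (mul_le_mul_of_nonneg_right hcard hεC.le) hC.le
    _ = ε * ((M : ℝ) / (M + 1)) := by field_simp
    _ ≤ ε * 1 := by
        refine mul_le_mul_of_nonneg_left ?_ hε.le
        rw [div_le_one (by positivity)]
        linarith
    _ = ε := mul_one ε

/-- **UNIFORM MIXING ON `ℤ²`, unconditionally**: the same at `p_c(ℤ²) = 1/2` for every measure with Kesten's IIC limit property ((A2)□(9,77)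
from RSW; `θ(1/2) = 0` by Harris–Kesten). [cite: Kesten1986, Thm. (3), (1.12)–(1.13)] -/
theorem iicMeasure_abs_real_inter_preimage_shift_sub_le_Z2 {ν : Measure (BondConfig (Site 2))}
    (hν : ∀ (F : Finset (Sym2 (Site 2))) (E : Set (BondConfig (Site 2))), MeasurableSet E → DeterminedBy E ↑F →
      Tendsto (fun n : ℕ => (bondPercolation (zdGraph 2) (criticalProbI 2)).real (E ∩ siteToBoundary 2 n) /
        oneArmProb 2 (criticalProbI 2) n) atTop (𝓝 (ν.real E)))
    {F : Finset (Sym2 (Site 2))} {W : Finset (Site 2)} (hFW : ∀ e ∈ F, ∀ w ∈ e, w ∈ W)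
    {E : Set (BondConfig (Site 2))} (hE : DeterminedBy E (↑F : Set (Sym2 (Site 2)))) {ε : ℝ} (hε : 0 < ε) :
    ∃ n₀ : ℕ, ∀ v : Site 2, (∀ w ∈ W, w - v ∉ box 2 n₀) →
      ∀ (T : Finset (Sym2 (Site 2))) (G : Set (BondConfig (Site 2))), DeterminedBy G (↑T : Set (Sym2 (Site 2))) →
        Disjoint T (F.image (Sym2.map (Site.shift v).symm)) →
        |ν.real (G ∩ BondConfig.relabel (sym2Equiv (Site.shift v)) ⁻¹' E) -
            ν.real G * (bondPercolation (zdGraph 2) (criticalProbI 2)).real E| ≤ ε := by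
  classical
  obtain ⟨ϰ, hϰ, hA2⟩ := exists_setToSetQuasiMultAspectAt_two_of_criticalProbI_le
  obtain ⟨C, hC, hb⟩ := iicMeasure_abs_real_inter_sub_mul_le_criticalProbI (d := 2) le_rfl (s := 9) (L := 77) (by norm_num)
    (by norm_num) hϰ (hA2 _ le_rfl)
  have hθ : theta (zdGraph 2) 0 (criticalProbI 2) = 0 :=
    percolationContinuity_two kesten_criticalProb_Z2_holds harris_theta_half_holds
  have hlim : Tendsto (fun m : ℕ => oneArmProb 2 (criticalProbI 2) m) atTop (𝓝 0) := by
    have h := Literature.Probability.Percolation.tendsto_real_siteToBoundary (d := 2) (criticalProbI 2)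
    rw [hθ] at h
    exact h
  set M : ℕ := W.card with hM
  have hεC : 0 < ε / (C * (M + 1)) := by positivity
  obtain ⟨m₀, hm₀⟩ := eventually_atTop.1 ((tendsto_order.1 hlim).2 (ε / (C * (M + 1))) hεC)
  refine ⟨max 7 (2 * m₀ + 2), fun v hv T G hG hdisj => ?_⟩
  have hW' : ∀ w ∈ W.image (fun x => x - v), w ∉ box 2 (max 7 (2 * m₀ + 2)) := by
    intro w hw
    obtain ⟨a, ha, rfl⟩ := Finset.mem_image.1 hw
    exact hv a ha
  have hnorm : ∀ w ∈ W.image (fun x => x - v), max 7 (2 * m₀ + 2) < Site.supNorm w := fun w hw => by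
    by_contra h'
    push Not at h'
    exact hW' w hw (mem_box_iff_supNorm_le.2 h')
  have hW7 : ∀ w ∈ W.image (fun x => x - v), 7 ≤ Site.supNorm w := fun w hw => by
    have h1 := hnorm w hw
    omega
  have h := hb ν hν (F.image (Sym2.map (Site.shift v).symm)) (W.image fun x => x - v) _ T G (forall_mem_image_shift hFW v)
    hW7 (determinedBy_preimage_relabel_shift hE v) hG hdisj
  rw [bondPercolation_real_preimage_shift] at h
  refine h.trans ?_
  have hterm : ∀ w ∈ W.image (fun x => x - v), oneArmProb 2 (criticalProbI 2) ((Site.supNorm w - 1) / 2) ≤ ε / (C * (M + 1)) :=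
    fun w hw => by
      have h1 := hnorm w hw
      exact (hm₀ _ (by omega)).le
  have hcard : ((W.image fun x => x - v).card : ℝ) ≤ M := by exact_mod_cast Finset.card_image_le
  calc C * ∑ w ∈ W.image (fun x => x - v), oneArmProb 2 (criticalProbI 2) ((Site.supNorm w - 1) / 2)
      ≤ C * ∑ _w ∈ W.image (fun x => x - v), ε / (C * (M + 1)) := mul_le_mul_of_nonneg_left (Finset.sum_le_sum hterm) hC.le
    _ = C * ((W.image fun x => x - v).card * (ε / (C * (M + 1)))) := by rw [Finset.sum_const, nsmul_eq_mul]
    _ ≤ C * ((M : ℝ) * (ε / (C * (M + 1)))) := mul_le_mul_of_nonneg_left (mul_le_mul_of_nonneg_right hcard hεC.le) hC.le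
    _ = ε * ((M : ℝ) / (M + 1)) := by field_simp
    _ ≤ ε * 1 := by
        refine mul_le_mul_of_nonneg_left ?_ hε.le
        rw [div_le_one (by positivity)]
        linarith
    _ = ε := mul_one ε

/-! ## Mean ergodic averages -/

/-- **THE EXPECTED DENSITY OF A LOCAL PATTERN UNDER THE IIC IS ASYMPTOTICALLY CRITICAL (ℤ^d, under (A2)□)**: at `p_c(ℤ^d)`, `d ≥ 2`, under
(A2)□ at aspect `(s,L)`, for every probability measure `ν` with Kesten's IIC limit property and every cylinder event `E`:
**`|Λ(n)|⁻¹ · Σ_{x ∈ Λ(n)} ν({ω | ω + x ∈ E}) → P_{p_c}(E)`** — the `ν`-expected proportion of sites `x ∈ Λ(n)` around which the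
translated pattern `E` occurs tends to its critical probability (Cesàro form of `iicMeasure_tendsto_real_preimage_shift_criticalProbI`).
[cite: Kesten1986, Thm. (3), (1.12)–(1.13)] [cite: BasuSapozhnikov2017ECP, Thm. 1.1 and §1 (A2)] -/
theorem iicMeasure_tendsto_boxAverage_real_preimage_shift_criticalProbI (hd : 2 ≤ d) {s L : ℕ} (hs : 2 ≤ s) (hsL : s ≤ L) {ϰ : ℝ}
    (hϰ : 0 < ϰ) (hA2 : SetToSetQuasiMultAspectAt d (criticalProbI d) s L ϰ) {ν : Measure (BondConfig (Site d))}
    [IsProbabilityMeasure ν]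
    (hν : ∀ (F : Finset (Sym2 (Site d))) (E : Set (BondConfig (Site d))), MeasurableSet E → DeterminedBy E ↑F →
      Tendsto (fun n : ℕ => (bondPercolation (zdGraph d) (criticalProbI d)).real (E ∩ siteToBoundary d n) /
        oneArmProb d (criticalProbI d) n) atTop (𝓝 (ν.real E)))
    {F : Finset (Sym2 (Site d))} {E : Set (BondConfig (Site d))} (hE : DeterminedBy E (↑F : Set (Sym2 (Site d)))) :
    Tendsto (fun n : ℕ => (∑ x ∈ box d n, ν.real (BondConfig.relabel (sym2Equiv (Site.shift x)) ⁻¹' E)) / ((box d n).card : ℝ))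
      atTop (𝓝 ((bondPercolation (zdGraph d) (criticalProbI d)).real E)) := by
  refine tendsto_boxAverage_of_tendsto_cofinite (by omega) (M := 2) (fun x => ?_)
    (iicMeasure_tendsto_real_preimage_shift_criticalProbI hd hs hsL hϰ hA2 hν hE)
  have h1 : ν.real (BondConfig.relabel (sym2Equiv (Site.shift x)) ⁻¹' E) ≤ 1 := measureReal_le_one
  have h2 : (bondPercolation (zdGraph d) (criticalProbI d)).real E ≤ 1 := measureReal_le_one
  have h3 : 0 ≤ ν.real (BondConfig.relabel (sym2Equiv (Site.shift x)) ⁻¹' E) := measureReal_nonneg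
  have h4 : 0 ≤ (bondPercolation (zdGraph d) (criticalProbI d)).real E := measureReal_nonneg
  rw [abs_le]
  constructor <;> linarith

/-- **THE EXPECTED DENSITY OF A LOCAL PATTERN UNDER THE PLANAR IIC IS ASYMPTOTICALLY CRITICAL, unconditionally**: for every probability measure
`ν` with Kesten's IIC limit property at `p_c(ℤ²)` and every cylinder event `E`: **`|Λ(n)|⁻¹ · Σ_{x ∈ Λ(n)} ν({ω | ω + x ∈ E}) → P_{1/2}(E)`**.
[cite: Kesten1986, Thm. (3), (1.12)–(1.13)] -/
theorem iicMeasure_tendsto_boxAverage_real_preimage_shift_Z2 {ν : Measure (BondConfig (Site 2))} [IsProbabilityMeasure ν]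
    (hν : ∀ (F : Finset (Sym2 (Site 2))) (E : Set (BondConfig (Site 2))), MeasurableSet E → DeterminedBy E ↑F →
      Tendsto (fun n : ℕ => (bondPercolation (zdGraph 2) (criticalProbI 2)).real (E ∩ siteToBoundary 2 n) /
        oneArmProb 2 (criticalProbI 2) n) atTop (𝓝 (ν.real E)))
    {F : Finset (Sym2 (Site 2))} {E : Set (BondConfig (Site 2))} (hE : DeterminedBy E (↑F : Set (Sym2 (Site 2)))) :
    Tendsto (fun n : ℕ => (∑ x ∈ box 2 n, ν.real (BondConfig.relabel (sym2Equiv (Site.shift x)) ⁻¹' E)) / ((box 2 n).card : ℝ))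
      atTop (𝓝 ((bondPercolation (zdGraph 2) (criticalProbI 2)).real E)) := by
  refine tendsto_boxAverage_of_tendsto_cofinite (d := 2) (by norm_num) (M := 2) (fun x => ?_)
    (iicMeasure_tendsto_real_preimage_shift_Z2 hν hE)
  have h1 : ν.real (BondConfig.relabel (sym2Equiv (Site.shift x)) ⁻¹' E) ≤ 1 := measureReal_le_one
  have h2 : (bondPercolation (zdGraph 2) (criticalProbI 2)).real E ≤ 1 := measureReal_le_one
  have h3 : 0 ≤ ν.real (BondConfig.relabel (sym2Equiv (Site.shift x)) ⁻¹' E) := measureReal_nonneg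
  have h4 : 0 ≤ (bondPercolation (zdGraph 2) (criticalProbI 2)).real E := measureReal_nonneg
  rw [abs_le]
  constructor <;> linarith

end Summit.CriticalPhenomena.PercolationContinuityZ3.Theorems.Crossing

end
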